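import Mathlib
import Summits.NavierStokesRegularity.NavierStokesRegularity.Theorems.DssFarFieldSlavingBlowupTypeIDssProfileSimilarityEnstrophyLambCore
import Summits.NavierStokesRegularity.NavierStokesRegularity.Theorems.DssFarFieldSlavingBlowupTypeIDssProfileSmoothRepresentativeAe
import Literature.Analysis.FluidPDE.TypeIAncientMildDecay
import Literature.Analysis.FluidPDE.LeiZhang2011Proofs
import HarnessLib

/-!
# T49 — the Λ-DIRECTIONAL FLOOR: the time-only threshold `θ < 1` read on the component of the velocity along the
  vortex-Lamb vector `ω × curl ω` — CLASSICAL (similarity and physical variables) and CLASS level, UNCONDITIONAL;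
  Row 2′ as the special case
  (pub-ns-dss theory EXPLICIT-THRESHOLDS v2.41 row T49 «Λ-DIRECTIONAL FLOOR» on SLAVING-GAP v1.0/v1.1 §5.2 (i) bare form;
  red ×2 PASS FINDINGS Gen 63 + pre-registered read-back checklist §S7; lead A503 (b), A504 (b)–(e), A505, A506 (e);
  route `DssFarFieldSlaving`, crux `BlowupTypeIDssProfile`, stmt-NavierStokesRegularity-0155 — SUPPORT; typer seats g14/g15,
  2026-08-25; v2 = g14 FINAL bytes fce19adfd8c77876 with the Row 2′ corollary demoted to an `example` per the gate's
  `dedup.landed` rule — statements of the six theorems byte-identical)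

HONEST FRAMING. Exclusion statements about a HYPOTHETICAL object (a KNSS-gauge Type-I field / a member of the
rotated-DSS Type-I class of `RdssProfileTruncation`). CLASS statement (theory row T49, ∀-representative shape of
Row 2′, class C_H3 verbatim): for every space–time Type-I level `M` and every `θ < 1`, NO non-trivial member of the
class has all its smooth KNSS representatives `V` with `√(−t)·|⟪V(t,x), ω × curl ω⟫| ≤ θ·‖ω × curl ω‖(t,x)` for all
`t < 0` and all `x` (`ω = curl V(t)`; `ω × curl ω` the vortex-Lamb vector of the vorticity field) —
`rdssClass_empty_of_lambDirection`. CLASSICAL statement: at ANY Type-I level `C₀` given the envelope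
`HasTypeIDecay C₀ V`, the ONE-SIDED hypothesis `√(−t)·⟪V, ω × curl ω⟫ ≤ θ·‖ω × curl ω‖` for all `t < 0`, `x` with
`θ < 1` forces `V ≡ 0` (`typeI_ancient_eq_zero_of_lambDirection_lt_one`; similarity form
`typeI_ancient_eq_zero_of_lambDirection_lt_one_sim`: `⟪U, Ω × curl Ω⟫ ≤ θ‖Ω × curl Ω‖` for all `s, y` — the same
inequality by the KNSS scaling `ω × curl ω = (−t)^{−5/2} Ω × curl Ω`, `⟪V, ω × curl ω⟫ = (−t)^{−3}⟪U, Ω × curl Ω⟫`).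
The special case `√(−t)‖V‖ ≤ θ` is Row 2′ (`…SimilarityEnstrophyTimeConstantFloor`, 42nd landing) by one pointwise
Cauchy–Schwarz (`lambDirection_of_timeConstant`; the re-derivation of Row 2′'s classical statement is a kernel-checked
`example`, not a second declaration — the gate's `dedup.landed` rule, the tree's
`typeI_ancient_eq_zero_of_timeConstant_lt_one` stays the declaration of record); Row 2′'s
label stays Row 2′'s and «EVERY M < 1 — UNCONDITIONAL» stays the discharge's (39th), neither re-attributed; no
strictness inside the class is claimed (both are EMPTY statements). MECHANISM (unweighted similarity enstrophy,
`½Z′ = −D_F − ¼Z + Str`): `Str = ∫⟪U, Ω × curl Ω⟫` (`LambCore.integral_stretching_eq_integral_inner_lamb`)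
`≤ θ₊∫‖Ω‖‖curl Ω‖ ≤ ∫‖curl Ω‖² + (θ₊²/4)Z = ∫|∇Ω|²_F + (θ₊²/4)Z` — pointwise Young, then the whole-space `div`–`curl`
`L²` identity `LambCore.integral_norm_curl_lerayVorticity_sq_eq` (the ONE place the threshold is decided: exactly `1`;
the curl is never bounded pointwise by `|∇Ω|_F`) — closed by the tree's `typeI_ancient_eq_zero_of_stretching_le`
(`β = θ₊²/4 < ¼`, `θ₊ = max θ 0`; for `θ < 0` the hypothesis forces `Ω × curl Ω ≡ 0`) with (D) from the Literature
gauge bounds `IsTypeIAncientMild.gaugeBounds_of_hasTypeIDecay` (Chae–Wolf (3.6)). DSS-BLIND: `c`, `R`,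
`IsRotatedDSS` are discarded (R-89 wording). The hypothesis is a functional of the unknown field (an INDEX in the
sense of the cell's A28: the bare directional constant `M_ν := sup_{Λ ≠ 0} |⟪U, Λ/‖Λ‖⟫|`), not a parameter of the
class; nothing about the τ-robust or integrated brackets of SLAVING-GAP §5.2; no threshold is claimed sharp; nothing
at `θ ≥ 1`; census words on ACCEPT are the lead's (`lead/words-g15/w_t49.txt`). Nothing numeric about any candidate;
nothing here bears on Navier–Stokes regularity or blow-up.
-/

noncomputable section

set_option linter.dupNamespace false

namespace Summit.NavierStokesRegularity.NavierStokesRegularity.Theorems.SimilarityEnstrophy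

open MeasureTheory Set Filter Topology Module Metric InnerProductSpace Function
open scoped RealInnerProductSpace Laplacian ContDiff
open Literature.Analysis Literature.Analysis.FluidPDE
open Summit.NavierStokesRegularity.NavierStokesRegularity.Theorems.GaussianGap
open Summit.NavierStokesRegularity.NavierStokesRegularity.Theorems

/-! ### L4: the stretching bound from the Λ-directional hypothesis -/

/-- **Stretching bound from the Λ-directional hypothesis** (theory SLAVING-GAP §5.2 (i), one slice): for a
KNSS-gauge Type-I field under (D) at `k = 1, 2`, if `⟪U(s,y), Λ(s,y)⟫ ≤ θ‖Λ(s,y)‖` for all `y` at the slice `s`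
(`Λ = Ω × curl Ω`, `0 ≤ θ`), then `Str(s) ≤ ∫|∇Ω(s)|²_F + (θ²/4) Z(s)`: Lamb form of the stretching,
`‖Ω × curl Ω‖ ≤ ‖Ω‖‖curl Ω‖` (Literature `norm_cross_le_norm_mul_norm`), pointwise Young `θbc ≤ c² + (θ²/4)b²`, and `∫‖curl Ω‖² = ∫|∇Ω|²_F`. [this file] -/
theorem integral_stretching_le_of_lambDirection {M : ℝ}
    {V : ℝ → EuclideanSpace ℝ (Fin 3) → EuclideanSpace ℝ (Fin 3)} (hV : IsTypeIAncientMild M V) {C₁ C₂ : ℝ}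
    (hD1 : ∀ t < 0, ∀ x, (‖x‖ + Real.sqrt (-t)) ^ (1 + 1) * ‖iteratedFDeriv ℝ 1 (V t) x‖ ≤ C₁)
    (hD2 : ∀ t < 0, ∀ x, (‖x‖ + Real.sqrt (-t)) ^ (2 + 1) * ‖iteratedFDeriv ℝ 2 (V t) x‖ ≤ C₂)
    {θ : ℝ} (hθ0 : 0 ≤ θ) (s : ℝ)
    (hΛ : ∀ y : EuclideanSpace ℝ (Fin 3),
      ⟪lerayOrbit V s y, cross (lerayVorticity V s y) (curl (lerayVorticity V s) y)⟫ ≤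
        θ * ‖cross (lerayVorticity V s y) (curl (lerayVorticity V s) y)‖) :
    ∫ y, ⟪lerayVorticity V s y, fderiv ℝ (lerayOrbit V s) y (lerayVorticity V s y)⟫ ≤
      (∫ y, frobeniusNormSq (fderiv ℝ (lerayVorticity V s) y)) +
        (θ ^ 2 / 4) * ∫ y, ‖lerayVorticity V s y‖ ^ 2 := by
  have iC := integrable_norm_curl_lerayVorticity_sq hV hD2 s
  have iZ := integrable_norm_lerayVorticity_sq hV hD1 s
  have iΛ := integrable_inner_lerayOrbit_lamb hV hD1 hD2 s
  rw [integral_stretching_eq_integral_inner_lamb hV hD1 hD2 s,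
    ← integral_norm_curl_lerayVorticity_sq_eq hV hD1 hD2 s, ← integral_const_mul,
    ← integral_add iC (iZ.const_mul _)]
  refine integral_mono iΛ (iC.add (iZ.const_mul _)) fun y => ?_
  dsimp only
  have hb0 : 0 ≤ ‖lerayVorticity V s y‖ := norm_nonneg _
  have hc0 : 0 ≤ ‖curl (lerayVorticity V s) y‖ := norm_nonneg _
  have h1 : ⟪lerayOrbit V s y, cross (lerayVorticity V s y) (curl (lerayVorticity V s) y)⟫ ≤
      θ * (‖lerayVorticity V s y‖ * ‖curl (lerayVorticity V s) y‖) :=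
    (hΛ y).trans (mul_le_mul_of_nonneg_left (norm_cross_le_norm_mul_norm _ _) hθ0)
  have h2 : θ * (‖lerayVorticity V s y‖ * ‖curl (lerayVorticity V s) y‖) ≤
      ‖curl (lerayVorticity V s) y‖ ^ 2 + θ ^ 2 / 4 * ‖lerayVorticity V s y‖ ^ 2 := by
    nlinarith [sq_nonneg (‖curl (lerayVorticity V s) y‖ - θ * ‖lerayVorticity V s y‖ / 2)]
  linarith

/-! ### L5: the classical theorem in similarity variables -/

/-- **T49, CLASSICAL, similarity variables, UNCONDITIONAL.** A KNSS-gauge Type-I field `V`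
(`IsTypeIAncientMild C₀ V`, any level `C₀`) with the space–time envelope `HasTypeIDecay C₀ V` whose Leray orbit satisfies, for all
`s, y`, `⟪U(s,y), Ω × curl Ω (s,y)⟫ ≤ θ ‖Ω × curl Ω (s,y)‖` with `θ < 1`, vanishes on `t < 0`: gauge bounds (D) from
`IsTypeIAncientMild.gaugeBounds_of_hasTypeIDecay`, the stretching bound `integral_stretching_le_of_lambDirection`
with `θ⁺ = max θ 0`, and the tree's closing step `typeI_ancient_eq_zero_of_stretching_le` (`β = (θ⁺)²/4 < ¼`).
[this file; theory row T49, similarity form (the Lean hypothesis is the one-sided, stronger form)] -/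
theorem typeI_ancient_eq_zero_of_lambDirection_lt_one_sim {C₀ θ : ℝ}
    {V : ℝ → EuclideanSpace ℝ (Fin 3) → EuclideanSpace ℝ (Fin 3)} (hθ : θ < 1)
    (hV : IsTypeIAncientMild C₀ V) (hdec : HasTypeIDecay C₀ V)
    (hΛ : ∀ (s : ℝ) (y : EuclideanSpace ℝ (Fin 3)),
      ⟪lerayOrbit V s y, cross (lerayVorticity V s y) (curl (lerayVorticity V s) y)⟫ ≤
        θ * ‖cross (lerayVorticity V s y) (curl (lerayVorticity V s) y)‖) :
    ∀ t < 0, ∀ x, V t x = 0 := by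
  obtain ⟨C₁, C₂, C₃, hD1, hD2, hD3⟩ := IsTypeIAncientMild.gaugeBounds_of_hasTypeIDecay hV hdec
  have hθ'0 : 0 ≤ max θ 0 := le_max_right _ _
  have hθ'1 : max θ 0 < 1 := max_lt hθ one_pos
  have hsq : (max θ 0) ^ 2 < 1 := by nlinarith
  have hβ : (max θ 0) ^ 2 / 4 < 1 / 4 := by linarith
  refine typeI_ancient_eq_zero_of_stretching_le hV hD1 hD2 hD3 hβ fun s => ?_
  exact integral_stretching_le_of_lambDirection hV hD1 hD2 hθ'0 s fun y =>
    (hΛ s y).trans (mul_le_mul_of_nonneg_right (le_max_left _ _) (norm_nonneg _))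

/-! ### L6: the physical-variables twin -/

/-- **The curl of the similarity vorticity rescales with weight `(−t)^{3/2}`**:
`curl Ω(s)(y) = (e^{−s} e^{−s/2}) • (curl ω)(t, x)` at `t = −e^{−s}`, `x = e^{−s/2} y`, `ω = curl V(t)`
(`Ω(s) = e^{−s} ω(t, e^{−s/2}·)`, `curl_lerayOrbit`; the curl is linear in the Jacobian). [folklore] -/
theorem curl_lerayVorticity_apply (V : ℝ → EuclideanSpace ℝ (Fin 3) → EuclideanSpace ℝ (Fin 3)) (s : ℝ)
    (y : EuclideanSpace ℝ (Fin 3)) :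
    curl (lerayVorticity V s) y =
      (Real.exp (-s) * Real.exp (-s / 2)) •
        curl (curl (V (-Real.exp (-s)))) (Real.exp (-s / 2) • y) := by
  have hfun : lerayVorticity V s =
      fun z => Real.exp (-s) • curl (V (-Real.exp (-s))) (Real.exp (-s / 2) • z) := by
    funext z
    rw [lerayVorticity_apply, curl_lerayOrbit]
  rw [curl_eq_curlCLM, hfun, fderiv_const_smul_comp_smul', map_smul, ← curl_eq_curlCLM]

/-- **T49, CLASSICAL, physical variables, UNCONDITIONAL** (theory EXPLICIT-THRESHOLDS row T49, classical form). A
KNSS-gauge Type-I field `V` at ANY Type-I level `C₀` (`IsTypeIAncientMild C₀ V`) with the envelope `HasTypeIDecay C₀ V`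
such that, at every `t < 0` and `x`, `√(−t)·⟪V(t,x), ω × curl ω⟫ ≤ θ ‖ω × curl ω‖`
(`ω = curl V(t)`, the vortex-Lamb vector `ω × curl ω` of the vorticity field evaluated at `(t,x)`) with `θ < 1`,
vanishes on `t < 0`. Proof: the hypothesis is scale-covariant (`U = λV`, `Ω = λ²ω`, `curl Ω = λ³ curl ω`,
`λ = √(−t) = e^{−s/2}`: both sides carry `λ⁵`), so `typeI_ancient_eq_zero_of_lambDirection_lt_one_sim` applies.
[this file; ONE-SIDED hypothesis (only the component along `+(ω × curl ω)` is constrained); conditional statement —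
nothing asserts the hypothesis for a given field; nothing here bears on NS regularity] -/
theorem typeI_ancient_eq_zero_of_lambDirection_lt_one {C₀ θ : ℝ}
    {V : ℝ → EuclideanSpace ℝ (Fin 3) → EuclideanSpace ℝ (Fin 3)} (hθ : θ < 1)
    (hV : IsTypeIAncientMild C₀ V) (hdec : HasTypeIDecay C₀ V)
    (hΛ : ∀ t < 0, ∀ x,
      Real.sqrt (-t) * ⟪V t x, cross (curl (V t) x) (curl (curl (V t)) x)⟫ ≤
        θ * ‖cross (curl (V t) x) (curl (curl (V t)) x)‖) :
    ∀ t < 0, ∀ x, V t x = 0 := by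
  refine typeI_ancient_eq_zero_of_lambDirection_lt_one_sim hθ hV hdec fun s y => ?_
  have hl0 : 0 < Real.exp (-s / 2) := Real.exp_pos _
  have hk0 : 0 < Real.exp (-s) := Real.exp_pos _
  have ht0 : -Real.exp (-s) < 0 := neg_neg_of_pos hk0
  have hU : lerayOrbit V s y =
      Real.exp (-s / 2) • V (-Real.exp (-s)) (Real.exp (-s / 2) • y) := by
    rw [lerayOrbit_apply]
  have hΩ : lerayVorticity V s y =
      Real.exp (-s) • curl (V (-Real.exp (-s))) (Real.exp (-s / 2) • y) := by
    rw [lerayVorticity_apply, curl_lerayOrbit]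
  have hC := curl_lerayVorticity_apply V s y
  have h := hΛ _ ht0 (Real.exp (-s / 2) • y)
  rw [neg_neg, sqrt_exp_neg] at h
  set P : ℝ := ⟪V (-Real.exp (-s)) (Real.exp (-s / 2) • y),
      cross (curl (V (-Real.exp (-s))) (Real.exp (-s / 2) • y))
        (curl (curl (V (-Real.exp (-s)))) (Real.exp (-s / 2) • y))⟫ with hP
  set N : ℝ := ‖cross (curl (V (-Real.exp (-s))) (Real.exp (-s / 2) • y))
      (curl (curl (V (-Real.exp (-s)))) (Real.exp (-s / 2) • y))‖ with hN
  have eL : ⟪lerayOrbit V s y, cross (lerayVorticity V s y) (curl (lerayVorticity V s) y)⟫ =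
      Real.exp (-s) * (Real.exp (-s) * Real.exp (-s / 2)) * (Real.exp (-s / 2) * P) := by
    rw [hU, hΩ, hC, cross_smul_left, cross_smul_right, real_inner_smul_left, real_inner_smul_right,
      real_inner_smul_right]
    ring
  have eR : ‖cross (lerayVorticity V s y) (curl (lerayVorticity V s) y)‖ =
      Real.exp (-s) * (Real.exp (-s) * Real.exp (-s / 2)) * N := by
    rw [hΩ, hC, cross_smul_left, cross_smul_right, norm_smul, norm_smul,
      Real.norm_of_nonneg hk0.le, Real.norm_of_nonneg (mul_pos hk0 hl0).le]
    ring
  have hw : 0 ≤ Real.exp (-s) * (Real.exp (-s) * Real.exp (-s / 2)) := by positivity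
  rw [eL, eR]
  calc Real.exp (-s) * (Real.exp (-s) * Real.exp (-s / 2)) * (Real.exp (-s / 2) * P)
      ≤ Real.exp (-s) * (Real.exp (-s) * Real.exp (-s / 2)) * (θ * N) :=
        mul_le_mul_of_nonneg_left h hw
    _ = θ * (Real.exp (-s) * (Real.exp (-s) * Real.exp (-s / 2)) * N) := by ring

/-! ### L7: Row 2′ as the special case, and the CLASS level -/

/-- **Row 2′ ⊂ Λ-floor**: the time-only constant bounds the Λ-directional constant —
`√(−t)‖V‖ ≤ θ` gives `√(−t)⟪V, X⟫ ≤ θ‖X‖` for every vector `X`, in particular `X = ω × curl ω`. [folklore] -/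
theorem lambDirection_of_timeConstant {θ : ℝ}
    {V : ℝ → EuclideanSpace ℝ (Fin 3) → EuclideanSpace ℝ (Fin 3)}
    (hb : ∀ t < 0, ∀ x, Real.sqrt (-t) * ‖V t x‖ ≤ θ) :
    ∀ t < 0, ∀ x,
      Real.sqrt (-t) * ⟪V t x, cross (curl (V t) x) (curl (curl (V t)) x)⟫ ≤
        θ * ‖cross (curl (V t) x) (curl (curl (V t)) x)‖ := by
  intro t ht x
  calc Real.sqrt (-t) * ⟪V t x, cross (curl (V t) x) (curl (curl (V t)) x)⟫
      ≤ Real.sqrt (-t) * (‖V t x‖ * ‖cross (curl (V t) x) (curl (curl (V t)) x)‖) :=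
        mul_le_mul_of_nonneg_left (real_inner_le_norm _ _) (Real.sqrt_nonneg _)
    _ = (Real.sqrt (-t) * ‖V t x‖) * ‖cross (curl (V t) x) (curl (curl (V t)) x)‖ := by ring
    _ ≤ θ * ‖cross (curl (V t) x) (curl (curl (V t)) x)‖ :=
        mul_le_mul_of_nonneg_right (hb t ht x) (norm_nonneg _)

/-- **Row 2′ re-derived through the Λ-floor** (the exact statement of the tree's
`…SimilarityEnstrophyTimeConstantFloor.typeI_ancient_eq_zero_of_timeConstant_lt_one` — which stays the declaration of
record: the gate's `dedup.landed` rule admits no second declaration of a landed statement, so this is a kernel-checked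
`example`, not a theorem — obtained from `typeI_ancient_eq_zero_of_lambDirection_lt_one` via
`lambDirection_of_timeConstant`): time-only constant `θ < 1` at any space–time level ⇒ `V ≡ 0`.
[this file; bookkeeping of «⊋ Row 2′»] -/
example {C₀ θ : ℝ}
    {V : ℝ → EuclideanSpace ℝ (Fin 3) → EuclideanSpace ℝ (Fin 3)} (hθ : θ < 1)
    (hV : IsTypeIAncientMild C₀ V) (hdec : HasTypeIDecay C₀ V)
    (hb : ∀ t < 0, ∀ x, Real.sqrt (-t) * ‖V t x‖ ≤ θ) :
    ∀ t < 0, ∀ x, V t x = 0 :=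
  typeI_ancient_eq_zero_of_lambDirection_lt_one hθ hV hdec (lambDirection_of_timeConstant hb)

/-- **T49 — the Λ-DIRECTIONAL FLOOR at CLASS level, UNCONDITIONAL** (theory EXPLICIT-THRESHOLDS v2.41 row T49;
∀-representative shape of Row 2′'s `rdssClass_empty_of_timeConstant` with `‖V‖` replaced by the component of `V`
along `ω × curl ω`; class C_H3 verbatim). For every space–time Type-I level `M` and every `θ < 1`: NO non-trivial
member of the hypothesis class of `RdssProfileTruncation` (`1 < c`, `IsAncientMildSolution 1 u`, measurable slices,
`IsRotatedDSS c R u` with ANY twist `R ∈ O(3)`, `HasTypeIDecay M u`) has all its smooth KNSS representatives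
(`IsTypeIAncientMild M V`, `V(t) = u(t)` a.e.) satisfying
`√(−t)·|⟪V(t,x), ω × curl ω⟫| ≤ θ·‖ω × curl ω‖(t,x)` for all `t < 0` and all `x` (`ω = curl V(t)`; two-sided form
as in the theory row — the one-sided form along `+(ω × curl ω)` already suffices,
`typeI_ancient_eq_zero_of_lambDirection_lt_one`). Equivalently (portrait reading, an index, never a gate): every
survivor has, at every `M`, bare directional constant `sup_{Λ ≠ 0} |⟪U, Λ/‖Λ‖⟫| ≥ 1` in similarity units. Proof:
a smooth representative exists (`typeI_ancient_smoothRepresentative_ae`), carries `HasTypeIDecay M V`, and vanishes.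
DSS-blind. [this file; theory row T49 (DERIVED theory g16 SLAVING-GAP §5.2 (i); red ×2 PASS Gen 63); census words
on ACCEPT, if any, are the lead's (`lead/words-g15/w_t49.txt`); nothing numerical is asserted; no sharpness claimed;
nothing here bears on NS regularity] -/
theorem rdssClass_empty_of_lambDirection (M : ℝ) {θ : ℝ} (hθ : θ < 1) :
    ¬ ∃ (c : ℝ) (R : (EuclideanSpace ℝ (Fin 3)) ≃ₗᵢ[ℝ] (EuclideanSpace ℝ (Fin 3)))
        (u : ℝ → (EuclideanSpace ℝ (Fin 3)) → (EuclideanSpace ℝ (Fin 3))),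
      1 < c ∧ IsAncientMildSolution 1 u ∧ (∀ t < 0, AEStronglyMeasurable (u t) volume) ∧
      IsRotatedDSS c R u ∧ HasTypeIDecay M u ∧
      (∀ V : ℝ → EuclideanSpace ℝ (Fin 3) → EuclideanSpace ℝ (Fin 3), IsTypeIAncientMild M V →
        (∀ t < 0, V t =ᵐ[volume] u t) →
        ∀ t < 0, ∀ x,
          Real.sqrt (-t) * |⟪V t x, cross (curl (V t) x) (curl (curl (V t)) x)⟫| ≤
            θ * ‖cross (curl (V t) x) (curl (curl (V t)) x)‖) ∧
      ¬ (∀ t < 0, u t =ᵐ[volume] 0) := by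
  rintro ⟨c, R, u, -, hmild, hmeas, -, hdec, hrep, hne⟩
  obtain ⟨V, hT, hdecV, hVu, -⟩ := typeI_ancient_smoothRepresentative_ae hmild hmeas hdec
  have hz : ∀ t < 0, ∀ x, V t x = 0 :=
    typeI_ancient_eq_zero_of_lambDirection_lt_one hθ hT hdecV fun t ht x =>
      (mul_le_mul_of_nonneg_left (le_abs_self _) (Real.sqrt_nonneg _)).trans (hrep V hT hVu t ht x)
  refine hne fun t ht => ?_
  have hVz : V t = 0 := funext fun x => by simpa using hz t ht x
  exact (hVu t ht).symm.trans (Filter.EventuallyEq.of_eq hVz)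

end Summit.NavierStokesRegularity.NavierStokesRegularity.Theorems.SimilarityEnstrophy
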